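import Literature.Probability.RandomPlanarGeometry.PlanarSkorokhodCoupling
import HarnessLib

/-!
# The planar Skorokhod coupling up to the exit of a large disc (Lawler 1996, Lemma 3.2)

Topic `Literature/Probability/RandomPlanarGeometry`, sub-namespace `SkorokhodSRW`; theorems only,
no definition and no named fact.

Brick B3g of Part B of the printed proof of `LSW2001_srw_nonIntersection_five_eighths`. Lawler,
*Cut times for simple random walk*, EJP **1** (1996), paper 13, §3, after Lemma 3.1: "Let
`T_n = inf{t : |B_t| = n}` … More exponential estimates give `P{T_n ≥ n^{2+ε}} ≤ a e^{-n^δ}` …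
Hence **Lemma 3.2.** … for every `ε > 0` there exist `δ > 0` and `a < ∞` such that
`P{sup_{0 ≤ t ≤ T_{8n}} |B(t) - S(td)| ≥ n^{1/2+ε}} ≤ a e^{-n^δ}`."

For the rotation coupling of `PlanarSkorokhodCoupling` (planar simple random walk `S`, planar
Brownian motion `W` with `W(2t)` standard, compared at the integer times `k`) we prove the
corresponding statement with the random horizon expressed through the first coordinate of `W`:

* `wienerLawC_confined_le_pow` — **confinement is exponentially unlikely**:
  `W[∀ s ≤ T, |p(s)| < r] ≤ θ₀^k` whenever `k (2r)² ≤ T` (geometric tail of the exit time of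
  `(-r, r)`, `BrownianExitIntervalTail`);
* `measure_exists_confined_and_le_norm_sub_le` — **Lemma 3.2 (d = 2)**: for every `ε > 0` there
  are `δ > 0`, `a < ∞` with
  `P[∃ k, (∀ t < k, |W₀(t)| < 8n) ∧ n^{1/2+ε} ≤ ‖S_k - W(k)‖_∞] ≤ a e^{-n^δ}` for all `n ≥ 1`;
  since `‖W(t)‖ ≥ |W₀(t)|` for the Euclidean and the sup norm alike, the event contains
  "`‖S_k - W(k)‖_∞ ≥ n^{1/2+ε}` for some integer `k` before `W` leaves the disc of radius `8n`".

## References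

* G. F. Lawler, *Cut times for simple random walk*, Electron. J. Probab. **1** (1996), no. 13,
  §3, Lemma 3.2. [Lawler1996CutTimes]
-/

noncomputable section

open MeasureTheory ProbabilityTheory Filter Set Real
open scoped NNReal ENNReal Topology

namespace Literature.Probability.RandomPlanarGeometry

namespace SkorokhodSRW

open Literature.Probability.LatticeModels Literature.Probability.LatticeModels.SRW

/-! ### Positions do not depend on the horizon -/

/-- The position of the planar walk after `k` steps does not depend on the horizon `N ≥ k` of
the step sequence used to read it. [folklore] -/
theorem pos_planarSteps_of_le {k N : ℕ} (hk : k ≤ N) (ω : C(ℝ≥0, ℝ) × C(ℝ≥0, ℝ)) :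
    pos (planarSteps N ω) k = pos (planarSteps k ω) k := by
  rw [pos_eq_sum_range _ hk, pos_eq_sum_range _ le_rfl]
  refine Finset.sum_congr rfl fun i hi ↦ ?_
  have hi' : i < k := Finset.mem_range.1 hi
  rw [dif_pos (hi'.trans_le hk), dif_pos hi']
  rfl

/-! ### Elementary bookkeeping -/

/-- A number `θ ∈ [0, 1)` is dominated by a decaying exponential: `θ ≤ e^{-c}` for some `c > 0`.
[folklore] -/
theorem exists_pos_le_exp_neg {θ : ℝ} (h0 : 0 ≤ θ) (h1 : θ < 1) : ∃ c : ℝ, 0 < c ∧ θ ≤ exp (-c) := by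
  rcases eq_or_lt_of_le h0 with h | h
  · exact ⟨1, one_pos, by rw [← h]; exact (exp_pos _).le⟩
  · refine ⟨-Real.log θ, by rw [neg_pos]; exact Real.log_neg h h1, ?_⟩
    rw [neg_neg, Real.exp_log h]

/-- Absorbing finitely many small `n`: if `P n ≤ 1` for all `n` and `P n ≤ a e^{-n^δ}` for
`n ≥ n₀`, then `P n ≤ a' e^{-n^δ}` for all `n ≥ 1`. [folklore] -/
theorem exists_bound_all {P : ℕ → ℝ} {δ a : ℝ} (hδ : 0 < δ) (ha : 0 < a) (hP1 : ∀ n, P n ≤ 1) {n₀ : ℕ}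
    (hP : ∀ n : ℕ, n₀ ≤ n → P n ≤ a * exp (-(n : ℝ) ^ δ)) :
    ∃ a' : ℝ, 0 < a' ∧ ∀ n : ℕ, 1 ≤ n → P n ≤ a' * exp (-(n : ℝ) ^ δ) := by
  refine ⟨max a (exp ((n₀ : ℝ) ^ δ)), lt_max_of_lt_left ha, fun n hn ↦ ?_⟩
  rcases le_or_gt n₀ n with h | h
  · exact (hP n h).trans (mul_le_mul_of_nonneg_right (le_max_left _ _) (exp_nonneg _))
  · have hn0 : (0 : ℝ) ≤ n := by positivity
    have hle : (n : ℝ) ^ δ ≤ (n₀ : ℝ) ^ δ :=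
      Real.rpow_le_rpow hn0 (by exact_mod_cast h.le) hδ.le
    calc P n ≤ 1 := hP1 n
      _ = exp ((n : ℝ) ^ δ) * exp (-(n : ℝ) ^ δ) := by rw [← Real.exp_add, add_neg_cancel, Real.exp_zero]
      _ ≤ max a (exp ((n₀ : ℝ) ^ δ)) * exp (-(n : ℝ) ^ δ) := by
          gcongr
          exact le_max_of_le_right (Real.exp_le_exp.2 hle)

/-! ### Confinement of a Wiener path is exponentially unlikely -/

/-- A path confined to `(-r, r)` up to time `T ≥ k (2r)²` has exit time of `(-r, r)` larger than
`k (2r)²`. [folklore] -/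
theorem coe_lt_pathExitTime_of_confined {r : ℝ} {T : ℝ≥0} {c : ℝ≥0} (hc : c ≤ T)
    {p : C(ℝ≥0, ℝ)} (hp : ∀ s ≤ T, |p s| < r) : (c : WithTop ℝ≥0) < pathExitTime (-r) r p := by
  by_contra h
  rw [not_lt] at h
  obtain ⟨j, hj, hjr⟩ := (Process.exitTime_le_coe_iff (u := coordProcess) (ω := p)
    (continuous_coordProcess p)).1 h
  exact hjr (by simpa [abs_lt] using hp j (hj.trans hc))

/-- The same for an arbitrary continuous-path process, along its path lift. [folklore] -/
theorem coe_lt_pathExitTime_toPathC_of_confined {Ω : Type*} {Y : ℝ≥0 → Ω → ℝ}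
    (hY : ∀ ω, Continuous fun t ↦ Y t ω) {r : ℝ} {T : ℝ≥0} {c : ℝ≥0} (hc : c ≤ T) {ω : Ω}
    (hp : ∀ s ≤ T, |Y s ω| < r) : (c : WithTop ℝ≥0) < pathExitTime (-r) r (toPathC Y hY ω) :=
  coe_lt_pathExitTime_of_confined hc (p := toPathC Y hY ω) hp

section Law

variable [MeasurableSpace C(ℝ≥0, ℝ)] [BorelSpace C(ℝ≥0, ℝ)]

/-- **Confinement is exponentially unlikely**: `W[∀ s ≤ T, |p(s)| < r] ≤ θ₀^k` whenever
`k (2r)² ≤ T`, `θ₀ = P[|N(0,1)| < 1]`. Lawler (1996), §3 ("`P{T_n ≥ n^{2+ε}} ≤ a e^{-n^δ}`").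
[cite: Lawler1996CutTimes, §3] -/
theorem wienerLawC_coe_lt_pathExitTime_le_pow {r : ℝ} (hr : 0 < r) (k : ℕ) :
    wienerLawC {p : C(ℝ≥0, ℝ) |
      ((((k : ℝ≥0) * ⟨(2 * r) ^ 2, sq_nonneg _⟩ : ℝ≥0)) : WithTop ℝ≥0) < pathExitTime (-r) r p} ≤
      gaussianReal 0 1 (Ioo (-1) 1) ^ k := by
  rw [wienerLawC_apply (measurableSet_coe_lt_pathExitTime _ _ _)]
  exact measure_mul_lt_exitTime_brownian_le_pow (a := -r) (b := r) (by linarith)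
    (h := ⟨(2 * r) ^ 2, sq_nonneg _⟩) (by show (2 * r) ^ 2 = (r - -r) ^ 2; ring) k

/-! ### Lemma 3.2 -/

/-- **Confinement of the first coordinate of `W` beyond the natural time scale is exponentially
unlikely**: `P[∀ t ≤ T, |W₀(t)| < r] ≤ θ₀^k` if `k (2r)² ≤ T/2` (`W₀(2s) = U(s)` is a Wiener path
under the product law, `PlanarWienerRotation.map_toPathC_rotU`). [cite: Lawler1996CutTimes, §3] -/
theorem measure_confined_planarBM_le_pow {r : ℝ} (hr : 0 < r) {T : ℝ≥0} {k : ℕ}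
    (hk : (k : ℝ≥0) * ⟨(2 * r) ^ 2, sq_nonneg _⟩ ≤ T / 2) :
    (wienerLawC.prod wienerLawC : Measure (C(ℝ≥0, ℝ) × C(ℝ≥0, ℝ)))
      {ω | ∀ t ≤ T, |planarBM t ω 0| < r} ≤ gaussianReal 0 1 (Ioo (-1) 1) ^ k := by
  set πU := toPathC (fun t (ω : C(ℝ≥0, ℝ) × C(ℝ≥0, ℝ)) ↦ (ω.1 (2 * t) + ω.2 (2 * t)) / 2)
    continuous_rotU with hπU
  set E := {p : C(ℝ≥0, ℝ) |
    ((((k : ℝ≥0) * ⟨(2 * r) ^ 2, sq_nonneg _⟩ : ℝ≥0)) : WithTop ℝ≥0) < pathExitTime (-r) r p} with hE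
  have hsub : {ω : C(ℝ≥0, ℝ) × C(ℝ≥0, ℝ) | ∀ t ≤ T, |planarBM t ω 0| < r} ⊆ πU ⁻¹' E := by
    intro ω hω
    refine coe_lt_pathExitTime_toPathC_of_confined continuous_rotU hk fun s hs ↦ ?_
    have h2s : 2 * s ≤ T := by
      calc 2 * s ≤ 2 * (T / 2) := by gcongr
        _ = T := mul_div_cancel₀ T two_ne_zero
    have := hω (2 * s) h2s
    exact this
  have hmeas : MeasurableSet E := measurableSet_coe_lt_pathExitTime _ _ _
  calc (wienerLawC.prod wienerLawC) {ω : C(ℝ≥0, ℝ) × C(ℝ≥0, ℝ) | ∀ t ≤ T, |planarBM t ω 0| < r}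
      ≤ (wienerLawC.prod wienerLawC) (πU ⁻¹' E) := measure_mono hsub
    _ = wienerLawC E := by
        rw [← Measure.map_apply (measurable_toPathC continuous_rotU measurable_rotU) hmeas,
          map_toPathC_rotU]
    _ ≤ gaussianReal 0 1 (Ioo (-1) 1) ^ k := wienerLawC_coe_lt_pathExitTime_le_pow hr k

omit [MeasurableSpace C(ℝ≥0, ℝ)] [BorelSpace C(ℝ≥0, ℝ)] in
/-- Threshold bookkeeping for Lemma 3.2: with `m = ⌈n^{2+ε/8}⌉` and `0 < ε ≤ 1`,
`m^{1/4+ε/8} ≤ n^{1/2+ε}` as soon as `n ≥ 2^{64/(45ε)}`. [folklore] -/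
theorem ceil_rpow_threshold {e : ℝ} (he : 0 < e) (he1 : e ≤ 1) {n : ℕ} (hn : 1 ≤ n)
    (hn₀ : (2 : ℝ) ^ (64 / (45 * e)) ≤ n) :
    ((⌈(n : ℝ) ^ (2 + e / 8)⌉₊ : ℕ) : ℝ) ^ (1 / 4 + e / 8) ≤ (n : ℝ) ^ (1 / 2 + e) := by
  have hn1 : (1 : ℝ) ≤ n := by exact_mod_cast hn
  have hn0 : (0 : ℝ) < n := by positivity
  set m := ⌈(n : ℝ) ^ (2 + e / 8)⌉₊ with hm
  have hpow1 : (1 : ℝ) ≤ (n : ℝ) ^ (2 + e / 8) := Real.one_le_rpow hn1 (by positivity)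
  have hm_le : (m : ℝ) ≤ 2 * (n : ℝ) ^ (2 + e / 8) := by
    have := (Nat.ceil_lt_add_one (by positivity : (0 : ℝ) ≤ (n : ℝ) ^ (2 + e / 8))).le
    rw [← hm] at this
    linarith
  have hexp0 : (0 : ℝ) < 1 / 4 + e / 8 := by positivity
  -- `m^{1/4+e/8} ≤ 2 n^{1/2 + 19e/64}`
  have h1 : (m : ℝ) ^ (1 / 4 + e / 8) ≤ 2 * (n : ℝ) ^ (1 / 2 + 19 * e / 64) := by
    calc (m : ℝ) ^ (1 / 4 + e / 8) ≤ (2 * (n : ℝ) ^ (2 + e / 8)) ^ (1 / 4 + e / 8) :=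
          Real.rpow_le_rpow (by positivity) hm_le hexp0.le
      _ = (2 : ℝ) ^ (1 / 4 + e / 8) * (n : ℝ) ^ ((2 + e / 8) * (1 / 4 + e / 8)) := by
          rw [Real.mul_rpow (by norm_num) (by positivity), ← Real.rpow_mul hn0.le]
      _ ≤ 2 * (n : ℝ) ^ (1 / 2 + 19 * e / 64) := by
          refine mul_le_mul ?_ ?_ (by positivity) (by norm_num)
          · calc (2 : ℝ) ^ (1 / 4 + e / 8) ≤ (2 : ℝ) ^ (1 : ℝ) :=
                  Real.rpow_le_rpow_of_exponent_le (by norm_num) (by linarith)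
              _ = 2 := Real.rpow_one 2
          · refine Real.rpow_le_rpow_of_exponent_le hn1 ?_
            nlinarith
  -- `2 ≤ n^{45e/64}`
  have h2 : (2 : ℝ) ≤ (n : ℝ) ^ (45 * e / 64) := by
    have hpos : (0 : ℝ) < 64 / (45 * e) := by positivity
    calc (2 : ℝ) = ((2 : ℝ) ^ (64 / (45 * e))) ^ (45 * e / 64) := by
          rw [← Real.rpow_mul (by norm_num)]
          have : 64 / (45 * e) * (45 * e / 64) = 1 := by field_simp
          rw [this, Real.rpow_one]
      _ ≤ (n : ℝ) ^ (45 * e / 64) := Real.rpow_le_rpow (by positivity) hn₀ (by positivity)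
  calc (m : ℝ) ^ (1 / 4 + e / 8) ≤ 2 * (n : ℝ) ^ (1 / 2 + 19 * e / 64) := h1
    _ ≤ (n : ℝ) ^ (45 * e / 64) * (n : ℝ) ^ (1 / 2 + 19 * e / 64) :=
        mul_le_mul_of_nonneg_right h2 (by positivity)
    _ = (n : ℝ) ^ (1 / 2 + e) := by
        rw [← Real.rpow_add hn0]
        congr 1
        ring

/-- **Lemma 3.2 of Lawler (1996), d = 2, main estimate** (for `0 < ε ≤ 1`, real form): with
`W₀` the first coordinate of the planar Brownian motion `W` and `S` the planar simple random walk
of the rotation coupling, for every `n ≥ 1`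
`P[∃ k, (∀ t < k, |W₀(t)| < 8n) ∧ n^{1/2+ε} ≤ ‖S_k - W(k)‖_∞] ≤ a e^{-n^δ}`.
[cite: Lawler1996CutTimes, Lemma 3.2] -/
theorem measureReal_exists_confined_and_le_norm_sub_le_of_le_one {e : ℝ} (he : 0 < e) (he1 : e ≤ 1) :
    ∃ δ : ℝ, 0 < δ ∧ ∃ a : ℝ, 0 < a ∧ ∀ n : ℕ, 1 ≤ n →
      (wienerLawC.prod wienerLawC : Measure (C(ℝ≥0, ℝ) × C(ℝ≥0, ℝ))).real
        {ω | ∃ k : ℕ, (∀ t : ℝ≥0, (t : ℝ) < k → |planarBM t ω 0| < 8 * n) ∧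
          (n : ℝ) ^ (1 / 2 + e) ≤
            ‖(fun j ↦ ((pos (planarSteps k ω) k j : ℤ) : ℝ)) - planarBM k ω‖} ≤
        a * exp (-(n : ℝ) ^ δ) := by
  set μ₂ := (wienerLawC.prod wienerLawC : Measure (C(ℝ≥0, ℝ) × C(ℝ≥0, ℝ))) with hμ₂
  -- the coupling bound at horizon `m` with exponent `e/8`
  obtain ⟨δ₁, hδ₁, a₁, ha₁, hB⟩ := measure_exists_le_norm_pos_sub_planarBM_le (e := e / 8) (by positivity)
  -- the confinement constant
  set θ := (gaussianReal 0 1).real (Ioo (-1) 1) with hθ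
  obtain ⟨c, hc, hθc⟩ := exists_pos_le_exp_neg (θ := θ) measureReal_nonneg
    gaussianReal_real_Ioo_neg_one_one_lt_one
  obtain ⟨a₂, ha₂, habs⟩ := exists_absorb_prefactor (c := c / 512) (d := e / 8) (by positivity)
    (by positivity)
  set δ := min δ₁ (e / 8 / 2) with hδ
  have hδpos : 0 < δ := lt_min hδ₁ (by positivity)
  -- the estimate for `n ≥ n₀`
  set n₀ := ⌈(2 : ℝ) ^ (64 / (45 * e))⌉₊ with hn₀
  have hP1 : ∀ n : ℕ, μ₂.real {ω | ∃ k : ℕ, (∀ t : ℝ≥0, (t : ℝ) < k → |planarBM t ω 0| < 8 * n) ∧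
      (n : ℝ) ^ (1 / 2 + e) ≤ ‖(fun j ↦ ((pos (planarSteps k ω) k j : ℤ) : ℝ)) - planarBM k ω‖} ≤ 1 :=
    fun n ↦ measureReal_le_one
  refine ⟨δ, hδpos, ?_⟩
  refine exists_bound_all hδpos (a := a₁ + exp c / 4 * a₂) (by positivity) hP1 (n₀ := max n₀ 1)
    fun n hn ↦ ?_
  have hn1 : 1 ≤ n := le_of_max_le_right hn
  have hnn₀ : n₀ ≤ n := le_of_max_le_left hn
  have hn1r : (1 : ℝ) ≤ n := by exact_mod_cast hn1
  have hn0 : (0 : ℝ) < n := by positivity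
  have hn₀r : (2 : ℝ) ^ (64 / (45 * e)) ≤ n := (Nat.le_ceil _).trans (by exact_mod_cast hnn₀)
  -- the horizon `m`
  set m := ⌈(n : ℝ) ^ (2 + e / 8)⌉₊ with hm
  have hm_ge : (n : ℝ) ^ (2 + e / 8) ≤ m := Nat.le_ceil _
  have hnpow : (n : ℝ) ≤ (n : ℝ) ^ (2 + e / 8) := by
    calc (n : ℝ) = (n : ℝ) ^ (1 : ℝ) := (Real.rpow_one _).symm
      _ ≤ (n : ℝ) ^ (2 + e / 8) := Real.rpow_le_rpow_of_exponent_le hn1r (by linarith)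
  have hnm : (n : ℝ) ≤ m := hnpow.trans hm_ge
  have hm1 : 1 ≤ m := by exact_mod_cast hn1r.trans hnm
  have hthr := ceil_rpow_threshold he he1 hn1 hn₀r
  rw [← hm] at hthr
  set x := (n : ℝ) ^ (1 / 2 + e) with hx
  -- the three events
  set A := {ω : C(ℝ≥0, ℝ) × C(ℝ≥0, ℝ) | ∃ k : ℕ, (∀ t : ℝ≥0, (t : ℝ) < k → |planarBM t ω 0| < 8 * n) ∧
    x ≤ ‖(fun j ↦ ((pos (planarSteps k ω) k j : ℤ) : ℝ)) - planarBM k ω‖} with hA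
  set B := {ω : C(ℝ≥0, ℝ) × C(ℝ≥0, ℝ) | ∃ k ≤ m, (m : ℝ) ^ (1 / 4 + e / 8) ≤
    ‖(fun j ↦ ((pos (planarSteps m ω) k j : ℤ) : ℝ)) - planarBM k ω‖} with hBdef
  set C := {ω : C(ℝ≥0, ℝ) × C(ℝ≥0, ℝ) | ∀ t ≤ (m : ℝ≥0), |planarBM t ω 0| < 8 * n} with hC
  have hcover : A ⊆ B ∪ C := by
    rintro ω ⟨k, hconf, hbad⟩
    by_cases hkm : k ≤ m
    · left
      refine ⟨k, hkm, hthr.trans ?_⟩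
      rw [pos_planarSteps_of_le hkm]
      exact hbad
    · right
      intro t ht
      refine hconf t ?_
      have : (m : ℝ) < k := by exact_mod_cast lt_of_not_ge hkm
      exact lt_of_le_of_lt (by exact_mod_cast ht) this
  -- bound for `B`
  have hBbound : μ₂.real B ≤ a₁ * exp (-(n : ℝ) ^ δ₁) := by
    have h := hB m hm1
    have h' : μ₂.real B ≤ a₁ * exp (-(m : ℝ) ^ δ₁) := by
      rw [measureReal_def]
      exact ENNReal.toReal_le_of_le_ofReal (by positivity) h
    refine h'.trans (mul_le_mul_of_nonneg_left (Real.exp_le_exp.2 (neg_le_neg ?_)) ha₁.le)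
    exact Real.rpow_le_rpow hn0.le hnm hδ₁.le
  -- bound for `C`
  have hCbound : μ₂.real C ≤ exp c / 4 * a₂ * exp (-(n : ℝ) ^ (e / 8 / 2)) := by
    set k₀ := ⌊((m : ℝ) / 2) / (256 * (n : ℝ) ^ 2)⌋₊ with hk₀
    have hk₀le : ((k₀ : ℝ≥0) * ⟨(2 * (8 * (n : ℝ))) ^ 2, sq_nonneg _⟩ : ℝ≥0) ≤ (m : ℝ≥0) / 2 := by
      rw [← NNReal.coe_le_coe]
      push_cast
      have h1 := Nat.floor_le (by positivity : (0 : ℝ) ≤ ((m : ℝ) / 2) / (256 * (n : ℝ) ^ 2))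
      rw [← hk₀] at h1
      have h2 : (0 : ℝ) < 256 * (n : ℝ) ^ 2 := by positivity
      calc (k₀ : ℝ) * (2 * (8 * (n : ℝ))) ^ 2 = (k₀ : ℝ) * (256 * (n : ℝ) ^ 2) := by ring
        _ ≤ ((m : ℝ) / 2) / (256 * (n : ℝ) ^ 2) * (256 * (n : ℝ) ^ 2) :=
            mul_le_mul_of_nonneg_right h1 h2.le
        _ = (m : ℝ) / 2 := div_mul_cancel₀ _ h2.ne'
    have hCle : μ₂ C ≤ gaussianReal 0 1 (Ioo (-1) 1) ^ k₀ :=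
      measure_confined_planarBM_le_pow (r := 8 * n) (by positivity) hk₀le
    have hCreal : μ₂.real C ≤ θ ^ k₀ := by
      rw [measureReal_def, hθ, measureReal_def, ← ENNReal.toReal_pow]
      exact ENNReal.toReal_mono (ENNReal.pow_ne_top (measure_ne_top _ _)) hCle
    -- `θ^{k₀} ≤ e^{-c k₀} ≤ e^c e^{-(c/512) n^{e/8}}`
    have hk₀ge : (n : ℝ) ^ (e / 8) / 512 - 1 ≤ k₀ := by
      have h1 := (Nat.lt_floor_add_one (((m : ℝ) / 2) / (256 * (n : ℝ) ^ 2))).le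
      rw [← hk₀] at h1
      have h2 : (n : ℝ) ^ (e / 8) / 512 ≤ ((m : ℝ) / 2) / (256 * (n : ℝ) ^ 2) := by
        rw [div_le_div_iff₀ (by norm_num) (by positivity)]
        have h3 : (n : ℝ) ^ (e / 8) * (n : ℝ) ^ 2 = (n : ℝ) ^ (2 + e / 8) := by
          rw [← Real.rpow_natCast, ← Real.rpow_add hn0]
          congr 1
          push_cast
          ring
        nlinarith [h3, hm_ge]
      linarith
    have hθk : θ ^ k₀ ≤ exp c * exp (-(c / 512 * (n : ℝ) ^ (e / 8))) := by
      calc θ ^ k₀ ≤ (exp (-c)) ^ k₀ := pow_le_pow_left₀ measureReal_nonneg hθc k₀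
        _ = exp (-c * k₀) := by rw [← Real.exp_nat_mul]; ring_nf
        _ ≤ exp (c + -(c / 512 * (n : ℝ) ^ (e / 8))) := Real.exp_le_exp.2 (by nlinarith)
        _ = exp c * exp (-(c / 512 * (n : ℝ) ^ (e / 8))) := Real.exp_add _ _
    have habs' := habs n hn1
    calc μ₂.real C ≤ θ ^ k₀ := hCreal
      _ ≤ exp c * exp (-(c / 512 * (n : ℝ) ^ (e / 8))) := hθk
      _ = exp c / 4 * (1 * (4 * exp (-(c / 512 * (n : ℝ) ^ (e / 8))))) := by ring
      _ ≤ exp c / 4 * ((n : ℝ) * (4 * exp (-(c / 512 * (n : ℝ) ^ (e / 8))))) := by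
          gcongr
      _ = exp c / 4 * (4 * (n : ℝ) * exp (-(c / 512 * (n : ℝ) ^ (e / 8)))) := by ring
      _ ≤ exp c / 4 * (a₂ * exp (-(n : ℝ) ^ (e / 8 / 2))) := by gcongr
      _ = exp c / 4 * a₂ * exp (-(n : ℝ) ^ (e / 8 / 2)) := by ring
  -- assemble
  have h1 := exp_neg_rpow_le (min_le_left δ₁ (e / 8 / 2)) hn1
  have h2 := exp_neg_rpow_le (min_le_right δ₁ (e / 8 / 2)) hn1
  calc μ₂.real A ≤ μ₂.real (B ∪ C) := measureReal_mono hcover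
    _ ≤ μ₂.real B + μ₂.real C := measureReal_union_le _ _
    _ ≤ a₁ * exp (-(n : ℝ) ^ δ₁) + exp c / 4 * a₂ * exp (-(n : ℝ) ^ (e / 8 / 2)) :=
        add_le_add hBbound hCbound
    _ ≤ a₁ * exp (-(n : ℝ) ^ δ) + exp c / 4 * a₂ * exp (-(n : ℝ) ^ δ) := by
        gcongr
    _ = (a₁ + exp c / 4 * a₂) * exp (-(n : ℝ) ^ δ) := by ring

/-- **Lemma 3.2 of Lawler (1996), d = 2** (real form): for every `ε > 0` there are `δ > 0` and
`a < ∞` such that for all `n ≥ 1`,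
`P[∃ k, (∀ t < k, |W₀(t)| < 8n) ∧ n^{1/2+ε} ≤ ‖S_k - W(k)‖_∞] ≤ a e^{-n^δ}` — an error of size
`n^{1/2+ε}` between the planar simple random walk and the planar Brownian motion at some
integer time before (the first coordinate of) `W` leaves `(-8n, 8n)` is exponentially unlikely.
[cite: Lawler1996CutTimes, Lemma 3.2] -/
theorem measureReal_exists_confined_and_le_norm_sub_le {e : ℝ} (he : 0 < e) :
    ∃ δ : ℝ, 0 < δ ∧ ∃ a : ℝ, 0 < a ∧ ∀ n : ℕ, 1 ≤ n →
      (wienerLawC.prod wienerLawC : Measure (C(ℝ≥0, ℝ) × C(ℝ≥0, ℝ))).real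
        {ω | ∃ k : ℕ, (∀ t : ℝ≥0, (t : ℝ) < k → |planarBM t ω 0| < 8 * n) ∧
          (n : ℝ) ^ (1 / 2 + e) ≤
            ‖(fun j ↦ ((pos (planarSteps k ω) k j : ℤ) : ℝ)) - planarBM k ω‖} ≤
        a * exp (-(n : ℝ) ^ δ) := by
  obtain ⟨δ, hδ, a, ha, h⟩ := measureReal_exists_confined_and_le_norm_sub_le_of_le_one
    (e := min e 1) (lt_min he one_pos) (min_le_right _ _)
  refine ⟨δ, hδ, a, ha, fun n hn ↦ le_trans (measureReal_mono fun ω hω ↦ ?_) (h n hn)⟩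
  obtain ⟨k, hconf, hbad⟩ := hω
  refine ⟨k, hconf, le_trans ?_ hbad⟩
  have hn1 : (1 : ℝ) ≤ n := by exact_mod_cast hn
  exact Real.rpow_le_rpow_of_exponent_le hn1 (by linarith [min_le_left e 1])

/-- **Lemma 3.2 of Lawler (1996), d = 2** (`ℝ≥0∞` form). [cite: Lawler1996CutTimes, Lemma 3.2] -/
theorem measure_exists_confined_and_le_norm_sub_le {e : ℝ} (he : 0 < e) :
    ∃ δ : ℝ, 0 < δ ∧ ∃ a : ℝ, 0 < a ∧ ∀ n : ℕ, 1 ≤ n →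
      (wienerLawC.prod wienerLawC : Measure (C(ℝ≥0, ℝ) × C(ℝ≥0, ℝ)))
        {ω | ∃ k : ℕ, (∀ t : ℝ≥0, (t : ℝ) < k → |planarBM t ω 0| < 8 * n) ∧
          (n : ℝ) ^ (1 / 2 + e) ≤
            ‖(fun j ↦ ((pos (planarSteps k ω) k j : ℤ) : ℝ)) - planarBM k ω‖} ≤
        ENNReal.ofReal (a * exp (-(n : ℝ) ^ δ)) := by
  obtain ⟨δ, hδ, a, ha, h⟩ := measureReal_exists_confined_and_le_norm_sub_le he
  refine ⟨δ, hδ, a, ha, fun n hn ↦ ?_⟩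
  rw [← ofReal_measureReal (measure_ne_top _ _)]
  exact ENNReal.ofReal_le_ofReal (h n hn)

end Law

end SkorokhodSRW

end Literature.Probability.RandomPlanarGeometry
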